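import Summits.CriticalPhenomena.PercolationContinuityZ3.Theorems.PercNearOneGluingNoHeavyLowerTailKnQuestion8CoefficientwiseCoreClassKernelMixHubBundlePath
import Summits.CriticalPhenomena.PercolationContinuityZ3.Theorems.PercNearOneGluingNoHeavyLowerTailKnQuestion8CoefficientwiseCoreClassKernelMixHubPathRuns
import HarnessLib

/-!
# Bundle words: the class of gated trace sets is closed under complement and slicing (glue for H≼_J on all bundles, layer 4)

Support file (`--supports stmt-CriticalPhenomena-4575`, closed), prover `prim-cplus-coupling` (gen 52).  No definitions, no notations,
no named facts, no sorries; standard axioms.  Memo `prim-cplus-coupling/A5-COUPLING-gen50.md` §2.6 (CLOSURE LEMMA (iii)), memo-51 §7(2).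

Setting of `…KernelMixHubBundleJoin` / `…HubBundleTrace` (`hE`, `hθ`, per-thread walls `D t` and runs `ri ra rj rb t` with `ℓ := ℓ t`,
red traces `TX` = generic trace with `(ri, rj)`, blue traces `TY` = generic trace with `(ra, rb)`).  The CLASS MEMBER of the hub structure
of `Θ_n` with gates `(g₁, g₂)` and monotone `𝒳, 𝒴` is the set `{ω ⊆ E n : ¬ 𝒳(TX g₁ n ω) ∧ 𝒴(TY g₂ n ω)}`.  This file shows:
* `hubB_compl_filter` — its image under the involution `· ∆ E n` is `{ω ⊆ E n : ¬ 𝒳(TY g₁ n ω) ∧ 𝒴(TX g₂ n ω)}` (complements swap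
  red and blue traces, `hubB_trace_compl` + `hubB_runs_compl`);
* `hubB_mem_splitImage` — membership in the image of a family of words of `Θ_{r+1}` under the split `ω ↦ (ω ∩ E r-part, θ r ω)`;
* `hubB_W_join_sliceForm` / `hubB_W_join_pathForm` — the defining condition of a class member of `Θ_{r+1}` at a join `ω' ∪ ζ̃`,
  rewritten as a class-member condition of `Θ_r` in `ω'` (gates `g ∨ [ζ saturated]`) and as a class-member condition of the path in `ζ`
  (gates `g ∨ [ω' saturated]`), the substituted functionals being monotone (`hubB_sliceSubst_mono`, `hubB_pathSubst_mono`);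
* `hubB_runs_mono` / `hubB_trace_mono` — adding red edges lengthens the red hub runs / enlarges the red traces and shrinks the blue ones
  (from `hubPath_ri/ra/rj/rb_spec`), so that status up-sets such as `{X ∈ 𝐀, Y ∉ 𝐁}` are hub-closed.
[cite: KozmaNitzan2024, Questions 8–9 (§5.5 p. 36) (context)]
-/

namespace Summit.CriticalPhenomena.PercolationContinuityZ3.Theorems

open Finset
open scoped symmDiff

namespace Coefficientwise

/-- A set not inside `E` stays outside under `· ∆ E`. [folklore] -/
theorem hubB_symmDiff_not_sub_gen {γ : Type*} [DecidableEq γ] (E ζ : Finset γ) (h : ¬ ζ ⊆ E) : ¬ ζ ∆ E ⊆ E := by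
  intro hsub
  apply h
  intro k hk
  by_contra hk'
  exact hk' (hsub (Finset.mem_symmDiff.mpr (Or.inl ⟨hk, hk'⟩)))

open Classical in
/-- **Complement of a class member** of the hub structure of `Θ_n`: the involution `· ∆ E n` maps
`{ω ⊆ E n : ¬𝒳(TX g₁ ω) ∧ 𝒴(TY g₂ ω)}` onto `{ω ⊆ E n : ¬𝒳(TY g₁ ω) ∧ 𝒴(TX g₂ ω)}`. [folklore] -/
theorem hubB_compl_filter (ℓ : ℕ → ℕ) (hℓ : ∀ t, 1 ≤ ℓ t)
    (E : ℕ → Finset (ℕ × ℕ)) (hE : ∀ n p, p ∈ E n ↔ p.1 < n ∧ 1 ≤ p.2 ∧ p.2 ≤ ℓ p.1)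
    (θ : ℕ → Finset (ℕ × ℕ) → Finset ℕ) (hθ : ∀ t ω k, k ∈ θ t ω ↔ (t, k) ∈ ω)
    (D : ℕ → Finset ℕ → Finset ℕ) (hD : ∀ t η, D t η = (Icc 1 (ℓ t - 1)).filter (fun k => ¬ (k ∈ η ↔ k + 1 ∈ η)))
    (ri ra rj rb : ℕ → Finset ℕ → ℕ)
    (hri : ∀ t η, ri t η = if 1 ∈ η then (if h : (D t η).Nonempty then (D t η).min' h else ℓ t) else 0)
    (hra : ∀ t η, ra t η = if 1 ∈ η then 0 else (if h : (D t η).Nonempty then (D t η).min' h else ℓ t))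
    (hrj : ∀ t η, rj t η = if ℓ t ∈ η then (if h : (D t η).Nonempty then ℓ t - (D t η).max' h else ℓ t) else 0)
    (hrb : ∀ t η, rb t η = if ℓ t ∈ η then 0 else (if h : (D t η).Nonempty then ℓ t - (D t η).max' h else ℓ t))
    (TX TY : Bool → ℕ → Finset (ℕ × ℕ) → Finset (ℕ × ℕ))
    (hTX : ∀ g n ω, TX g n ω = (range n).biUnion (fun t => (Icc 0 (ri t (θ t ω)) ∪
      (if (g = true ∨ ∃ s, s < n ∧ ri s (θ s ω) = ℓ s) then Icc (ℓ t - rj t (θ t ω)) (ℓ t) else ∅)).image (Prod.mk t)))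
    (hTY : ∀ g n ω, TY g n ω = (range n).biUnion (fun t => (Icc 0 (ra t (θ t ω)) ∪
      (if (g = true ∨ ∃ s, s < n ∧ ra s (θ s ω) = ℓ s) then Icc (ℓ t - rb t (θ t ω)) (ℓ t) else ∅)).image (Prod.mk t)))
    (n : ℕ) (g₁ g₂ : Bool) (X Y : Finset (ℕ × ℕ) → Prop) (Wp cWp : Finset (ℕ × ℕ) → Prop)
    (hWp : ∀ ω, Wp ω ↔ ¬ X (TX g₁ n ω) ∧ Y (TY g₂ n ω)) (hcWp : ∀ ω, cWp ω ↔ ¬ X (TY g₁ n ω) ∧ Y (TX g₂ n ω)) :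
    (∀ ω, ω ⊆ E n → (Wp (E n \ ω) ↔ cWp ω)) ∧
    ((E n).powerset.filter (fun ω => Wp ω)).image (fun ω => ω ∆ E n) = (E n).powerset.filter (fun ω => cWp ω) := by
  have hc1 : ∀ t η, t < n → ri t (Icc 1 (ℓ t) \ η) = ra t η ∧ rj t (Icc 1 (ℓ t) \ η) = rb t η := fun t η _ =>
    let h4 := hubB_runs_compl (ℓ t) (hℓ t) (D t) (hD t) (ri t) (ra t) (rj t) (rb t) (hri t) (hra t) (hrj t) (hrb t) η
    ⟨h4.1, h4.2.2.1⟩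
  have hc2 : ∀ t η, t < n → ra t (Icc 1 (ℓ t) \ η) = ri t η ∧ rb t (Icc 1 (ℓ t) \ η) = rj t η := fun t η _ =>
    let h4 := hubB_runs_compl (ℓ t) (hℓ t) (D t) (hD t) (ri t) (ra t) (rj t) (rb t) (hri t) (hra t) (hrj t) (hrb t) η
    ⟨h4.2.1, h4.2.2.2⟩
  have hXY : ∀ g ω, TX g n (E n \ ω) = TY g n ω := fun g ω =>
    hubB_trace_compl ℓ E hE θ hθ ri rj ra rb TX TY hTX hTY n hc1 g ω
  have hYX : ∀ g ω, TY g n (E n \ ω) = TX g n ω := fun g ω =>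
    hubB_trace_compl ℓ E hE θ hθ ra rb ri rj TY TX hTY hTX n hc2 g ω
  have hpt : ∀ ω, ω ⊆ E n → (Wp (E n \ ω) ↔ cWp ω) := fun ω _ => by rw [hWp, hcWp, hXY, hYX]
  refine ⟨hpt, ?_⟩
  ext ω
  rw [hubProd_mem_image_invol (fun ω => ω ∆ E n) (hubB_symmDiff_invol (E n)), Finset.mem_filter, Finset.mem_filter,
    Finset.mem_powerset, Finset.mem_powerset]
  by_cases hsub : ω ⊆ E n
  · have hc : ω ∆ E n = E n \ ω := hubB_symmDiff_eq_sdiff (E n) ω hsub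
    rw [hc, hpt ω hsub]
    constructor
    · rintro ⟨_, h⟩; exact ⟨hsub, h⟩
    · rintro ⟨_, h⟩; exact ⟨Finset.sdiff_subset, h⟩
  · constructor
    · rintro ⟨h, _⟩; exact absurd h (hubB_symmDiff_not_sub_gen (E n) ω hsub)
    · rintro ⟨h, _⟩; exact absurd h hsub

/-- **Membership in the split image.**  For a family `G` of words of `Θ_{r+1}`:
`(ω', ζ) ∈ G.image split ↔ ω' ⊆ E r ∧ ω' ∪ ζ̃ ∈ G`. [folklore] -/
theorem hubB_mem_splitImage (ℓ : ℕ → ℕ) (E : ℕ → Finset (ℕ × ℕ)) (hE : ∀ n p, p ∈ E n ↔ p.1 < n ∧ 1 ≤ p.2 ∧ p.2 ≤ ℓ p.1)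
    (θ : ℕ → Finset (ℕ × ℕ) → Finset ℕ) (hθ : ∀ t ω k, k ∈ θ t ω ↔ (t, k) ∈ ω)
    (r : ℕ) (G : Finset (Finset (ℕ × ℕ))) (hG : ∀ ω ∈ G, ω ⊆ E (r + 1)) (ω' : Finset (ℕ × ℕ)) (ζ : Finset ℕ) :
    (ω', ζ) ∈ G.image (fun ω => (ω.filter (fun p => p.1 < r), θ r ω)) ↔ ω' ⊆ E r ∧ ω' ∪ ζ.image (Prod.mk r) ∈ G := by
  constructor
  · intro h
    obtain ⟨ω, hω, hsplit⟩ := Finset.mem_image.mp h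
    obtain ⟨heq, hsub, _⟩ := hubB_split ℓ E hE θ hθ r ω (hG ω hω)
    have h1 : ω.filter (fun p => p.1 < r) = ω' := (Prod.mk.inj hsplit).1
    have h2 : θ r ω = ζ := (Prod.mk.inj hsplit).2
    rw [h1, h2] at heq
    rw [h1] at hsub
    exact ⟨hsub, by rw [← heq]; exact hω⟩
  · rintro ⟨hsub, hmem⟩
    refine Finset.mem_image.mpr ⟨_, hmem, ?_⟩
    rw [hubB_fst_join ℓ E hE r ω' hsub ζ, hubB_theta_join_self ℓ E hE θ hθ r ω' hsub ζ]

open Classical in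
/-- The substituted functional of the `Θ_r`-slice is monotone. [folklore] -/
theorem hubB_sliceSubst_mono (X : Finset (ℕ × ℕ) → Prop) (hXmono : ∀ S T : Finset (ℕ × ℕ), S ⊆ T → X S → X T)
    (r : ℕ) (ℓ : ℕ → ℕ) (c d : Prop) [Decidable c] [Decidable d] (I J : Finset ℕ) (S T : Finset (ℕ × ℕ)) (hST : S ⊆ T)
    (h : X (S ∪ (I ∪ (if (c ∨ d ∨ ∃ t, t < r ∧ (t, ℓ t) ∈ S) then J else ∅)).image (Prod.mk r))) :
    X (T ∪ (I ∪ (if (c ∨ d ∨ ∃ t, t < r ∧ (t, ℓ t) ∈ T) then J else ∅)).image (Prod.mk r)) := by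
  refine hXmono _ _ ?_ h
  refine Finset.union_subset_union hST (Finset.image_subset_image (Finset.union_subset_union (le_refl _) ?_))
  intro k hk
  rw [hubB_mem_ite_empty] at hk ⊢
  refine ⟨?_, hk.2⟩
  rcases hk.1 with h1 | h1 | ⟨t, ht, h1⟩
  · exact Or.inl h1
  · exact Or.inr (Or.inl h1)
  · exact Or.inr (Or.inr ⟨t, ht, hST h1⟩)

open Classical in
/-- The substituted functional of the path slice is monotone (uses `TX false ⊆ TX true`). [folklore] -/
theorem hubB_pathSubst_mono (X : Finset (ℕ × ℕ) → Prop) (hXmono : ∀ S T : Finset (ℕ × ℕ), S ⊆ T → X S → X T)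
    (r L : ℕ) (A B : Finset (ℕ × ℕ)) (hAB : A ⊆ B) (P Q : Finset ℕ) (hPQ : P ⊆ Q)
    (h : X ((if L ∈ P then B else A) ∪ P.image (Prod.mk r))) : X ((if L ∈ Q then B else A) ∪ Q.image (Prod.mk r)) := by
  refine hXmono _ _ (Finset.union_subset_union ?_ (Finset.image_subset_image hPQ)) h
  split_ifs with h1 h2
  · exact le_refl _
  · exact absurd (hPQ h1) h2
  · exact hAB
  · exact le_refl _

open Classical in
/-- **The class condition of `Θ_{r+1}` at a join, read in `Θ_r`** (slice at fixed `ζ`). [folklore] -/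
theorem hubB_W_join_sliceForm (ℓ : ℕ → ℕ)
    (E : ℕ → Finset (ℕ × ℕ)) (hE : ∀ n p, p ∈ E n ↔ p.1 < n ∧ 1 ≤ p.2 ∧ p.2 ≤ ℓ p.1)
    (θ : ℕ → Finset (ℕ × ℕ) → Finset ℕ) (hθ : ∀ t ω k, k ∈ θ t ω ↔ (t, k) ∈ ω)
    (D : ℕ → Finset ℕ → Finset ℕ) (hD : ∀ t η, D t η = (Icc 1 (ℓ t - 1)).filter (fun k => ¬ (k ∈ η ↔ k + 1 ∈ η)))
    (ri ra rj rb : ℕ → Finset ℕ → ℕ)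
    (hri : ∀ t η, ri t η = if 1 ∈ η then (if h : (D t η).Nonempty then (D t η).min' h else ℓ t) else 0)
    (hra : ∀ t η, ra t η = if 1 ∈ η then 0 else (if h : (D t η).Nonempty then (D t η).min' h else ℓ t))
    (hrj : ∀ t η, rj t η = if ℓ t ∈ η then (if h : (D t η).Nonempty then ℓ t - (D t η).max' h else ℓ t) else 0)
    (hrb : ∀ t η, rb t η = if ℓ t ∈ η then 0 else (if h : (D t η).Nonempty then ℓ t - (D t η).max' h else ℓ t))
    (TX TY : Bool → ℕ → Finset (ℕ × ℕ) → Finset (ℕ × ℕ))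
    (hTX : ∀ g n ω, TX g n ω = (range n).biUnion (fun t => (Icc 0 (ri t (θ t ω)) ∪
      (if (g = true ∨ ∃ s, s < n ∧ ri s (θ s ω) = ℓ s) then Icc (ℓ t - rj t (θ t ω)) (ℓ t) else ∅)).image (Prod.mk t)))
    (hTY : ∀ g n ω, TY g n ω = (range n).biUnion (fun t => (Icc 0 (ra t (θ t ω)) ∪
      (if (g = true ∨ ∃ s, s < n ∧ ra s (θ s ω) = ℓ s) then Icc (ℓ t - rb t (θ t ω)) (ℓ t) else ∅)).image (Prod.mk t)))
    (r : ℕ) (gX gY : Bool) (X Y : Finset (ℕ × ℕ) → Prop) (Wp : Finset (ℕ × ℕ) → Prop)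
    (hWp : ∀ ω, Wp ω ↔ ¬ X (TX gX (r + 1) ω) ∧ Y (TY gY (r + 1) ω))
    (ω' : Finset (ℕ × ℕ)) (hω' : ω' ⊆ E r) (ζ : Finset ℕ) :
    Wp (ω' ∪ ζ.image (Prod.mk r)) ↔
      ¬ X (TX (gX || decide (ri r ζ = ℓ r)) r ω' ∪ (Icc 0 (ri r ζ) ∪
          (if (gX = true ∨ ri r ζ = ℓ r ∨ ∃ t, t < r ∧ (t, ℓ t) ∈ TX (gX || decide (ri r ζ = ℓ r)) r ω')
            then Icc (ℓ r - rj r ζ) (ℓ r) else ∅)).image (Prod.mk r)) ∧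
        Y (TY (gY || decide (ra r ζ = ℓ r)) r ω' ∪ (Icc 0 (ra r ζ) ∪
          (if (gY = true ∨ ra r ζ = ℓ r ∨ ∃ t, t < r ∧ (t, ℓ t) ∈ TY (gY || decide (ra r ζ = ℓ r)) r ω')
            then Icc (ℓ r - rb r ζ) (ℓ r) else ∅)).image (Prod.mk r)) := by
  have hfi : ∀ t η, ri t η ≤ ℓ t := fun t η =>
    (hubB_runs_le (ℓ t) (D t) (hD t) (ri t) (ra t) (rj t) (rb t) (hri t) (hra t) (hrj t) (hrb t) η).1
  have hfa : ∀ t η, ra t η ≤ ℓ t := fun t η =>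
    (hubB_runs_le (ℓ t) (D t) (hD t) (ri t) (ra t) (rj t) (rb t) (hri t) (hra t) (hrj t) (hrb t) η).2.1
  rw [hWp, hubB_trace_join_sliceForm ℓ E hE θ hθ ri rj hfi TX hTX gX r ω' hω' ζ,
    hubB_trace_join_sliceForm ℓ E hE θ hθ ra rb hfa TY hTY gY r ω' hω' ζ]

open Classical in
/-- **The class condition of `Θ_{r+1}` at a join, read on the path** (slice at fixed `ω'`). [folklore] -/
theorem hubB_W_join_pathForm (ℓ : ℕ → ℕ)
    (E : ℕ → Finset (ℕ × ℕ)) (hE : ∀ n p, p ∈ E n ↔ p.1 < n ∧ 1 ≤ p.2 ∧ p.2 ≤ ℓ p.1)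
    (θ : ℕ → Finset (ℕ × ℕ) → Finset ℕ) (hθ : ∀ t ω k, k ∈ θ t ω ↔ (t, k) ∈ ω)
    (D : ℕ → Finset ℕ → Finset ℕ) (hD : ∀ t η, D t η = (Icc 1 (ℓ t - 1)).filter (fun k => ¬ (k ∈ η ↔ k + 1 ∈ η)))
    (ri ra rj rb : ℕ → Finset ℕ → ℕ)
    (hri : ∀ t η, ri t η = if 1 ∈ η then (if h : (D t η).Nonempty then (D t η).min' h else ℓ t) else 0)
    (hra : ∀ t η, ra t η = if 1 ∈ η then 0 else (if h : (D t η).Nonempty then (D t η).min' h else ℓ t))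
    (hrj : ∀ t η, rj t η = if ℓ t ∈ η then (if h : (D t η).Nonempty then ℓ t - (D t η).max' h else ℓ t) else 0)
    (hrb : ∀ t η, rb t η = if ℓ t ∈ η then 0 else (if h : (D t η).Nonempty then ℓ t - (D t η).max' h else ℓ t))
    (TX TY : Bool → ℕ → Finset (ℕ × ℕ) → Finset (ℕ × ℕ))
    (hTX : ∀ g n ω, TX g n ω = (range n).biUnion (fun t => (Icc 0 (ri t (θ t ω)) ∪
      (if (g = true ∨ ∃ s, s < n ∧ ri s (θ s ω) = ℓ s) then Icc (ℓ t - rj t (θ t ω)) (ℓ t) else ∅)).image (Prod.mk t)))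
    (hTY : ∀ g n ω, TY g n ω = (range n).biUnion (fun t => (Icc 0 (ra t (θ t ω)) ∪
      (if (g = true ∨ ∃ s, s < n ∧ ra s (θ s ω) = ℓ s) then Icc (ℓ t - rb t (θ t ω)) (ℓ t) else ∅)).image (Prod.mk t)))
    (r : ℕ) (gX gY : Bool) (X Y : Finset (ℕ × ℕ) → Prop) (Wp : Finset (ℕ × ℕ) → Prop)
    (hWp : ∀ ω, Wp ω ↔ ¬ X (TX gX (r + 1) ω) ∧ Y (TY gY (r + 1) ω))
    (ω' : Finset (ℕ × ℕ)) (hω' : ω' ⊆ E r) (ζ : Finset ℕ) :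
    Wp (ω' ∪ ζ.image (Prod.mk r)) ↔
      ¬ X ((if ℓ r ∈ (Icc 0 (ri r ζ) ∪ (if (gX || decide (∃ s, s < r ∧ ri s (θ s ω') = ℓ s)) = true then Icc (ℓ r - rj r ζ) (ℓ r) else ∅))
              then TX true r ω' else TX false r ω') ∪
            (Icc 0 (ri r ζ) ∪ (if (gX || decide (∃ s, s < r ∧ ri s (θ s ω') = ℓ s)) = true then Icc (ℓ r - rj r ζ) (ℓ r) else ∅)).image (Prod.mk r)) ∧
        Y ((if ℓ r ∈ (Icc 0 (ra r ζ) ∪ (if (gY || decide (∃ s, s < r ∧ ra s (θ s ω') = ℓ s)) = true then Icc (ℓ r - rb r ζ) (ℓ r) else ∅))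
              then TY true r ω' else TY false r ω') ∪
            (Icc 0 (ra r ζ) ∪ (if (gY || decide (∃ s, s < r ∧ ra s (θ s ω') = ℓ s)) = true then Icc (ℓ r - rb r ζ) (ℓ r) else ∅)).image (Prod.mk r)) := by
  have hfi : ∀ t η, ri t η ≤ ℓ t := fun t η =>
    (hubB_runs_le (ℓ t) (D t) (hD t) (ri t) (ra t) (rj t) (rb t) (hri t) (hra t) (hrj t) (hrb t) η).1
  have hfa : ∀ t η, ra t η ≤ ℓ t := fun t η =>
    (hubB_runs_le (ℓ t) (D t) (hD t) (ri t) (ra t) (rj t) (rb t) (hri t) (hra t) (hrj t) (hrb t) η).2.1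
  have hPX : Icc 0 (ri r ζ) ∪ (if (gX || decide (∃ s, s < r ∧ ri s (θ s ω') = ℓ s)) = true then Icc (ℓ r - rj r ζ) (ℓ r) else ∅) =
      Icc 0 (ri r ζ) ∪ (if (gX = true ∨ ∃ s, s < r ∧ ri s (θ s ω') = ℓ s) then Icc (ℓ r - rj r ζ) (ℓ r) else ∅) := by
    congr 1
    refine if_congr ?_ rfl rfl
    rw [Bool.or_eq_true, decide_eq_true_eq]
  have hPY : Icc 0 (ra r ζ) ∪ (if (gY || decide (∃ s, s < r ∧ ra s (θ s ω') = ℓ s)) = true then Icc (ℓ r - rb r ζ) (ℓ r) else ∅) =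
      Icc 0 (ra r ζ) ∪ (if (gY = true ∨ ∃ s, s < r ∧ ra s (θ s ω') = ℓ s) then Icc (ℓ r - rb r ζ) (ℓ r) else ∅) := by
    congr 1
    refine if_congr ?_ rfl rfl
    rw [Bool.or_eq_true, decide_eq_true_eq]
  rw [hWp, hubB_trace_join_pathForm ℓ E hE θ hθ ri rj hfi TX hTX gX r ω' hω' ζ _ hPX,
    hubB_trace_join_pathForm ℓ E hE θ hθ ra rb hfa TY hTY gY r ω' hω' ζ _ hPY]

/-- **Runs are monotone**: adding red edges lengthens the red hub runs and shortens the blue ones. [folklore] -/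
theorem hubB_runs_mono (L : ℕ) (hL : 1 ≤ L) (D : Finset ℕ → Finset ℕ)
    (hD : ∀ ω, D ω = (Icc 1 (L - 1)).filter (fun k => ¬ (k ∈ ω ↔ k + 1 ∈ ω)))
    (ri ra rj rb : Finset ℕ → ℕ)
    (hri : ∀ ω, ri ω = if 1 ∈ ω then (if h : (D ω).Nonempty then (D ω).min' h else L) else 0)
    (hra : ∀ ω, ra ω = if 1 ∈ ω then 0 else (if h : (D ω).Nonempty then (D ω).min' h else L))
    (hrj : ∀ ω, rj ω = if L ∈ ω then (if h : (D ω).Nonempty then L - (D ω).max' h else L) else 0)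
    (hrb : ∀ ω, rb ω = if L ∈ ω then 0 else (if h : (D ω).Nonempty then L - (D ω).max' h else L))
    (η η' : Finset ℕ) (hsub : η ⊆ η') :
    ri η ≤ ri η' ∧ ra η' ≤ ra η ∧ rj η ≤ rj η' ∧ rb η' ≤ rb η := by
  have si := hubPath_ri_spec L hL D hD ri hri η
  have si' := hubPath_ri_spec L hL D hD ri hri η'
  have sa := hubPath_ra_spec L hL D hD ra hra η
  have sa' := hubPath_ra_spec L hL D hD ra hra η'
  have sj := hubPath_rj_spec L hL D hD rj hrj η
  have sj' := hubPath_rj_spec L hL D hD rj hrj η'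
  have sb := hubPath_rb_spec L hL D hD rb hrb η
  have sb' := hubPath_rb_spec L hL D hD rb hrb η'
  refine ⟨?_, ?_, ?_, ?_⟩
  · by_contra hlt
    rcases si'.2.2 with h | h
    · omega
    · exact h (hsub (si.1 (Finset.mem_Icc.mpr ⟨by omega, by omega⟩)))
  · by_contra hlt
    rcases sa.2.2 with h | h
    · omega
    · exact sa'.1 (ra η + 1) (Finset.mem_Icc.mpr ⟨by omega, by omega⟩) (hsub h)
  · by_contra hlt
    rcases sj'.2.2 with h | h
    · omega
    · exact h (hsub (sj.1 (Finset.mem_Icc.mpr ⟨by omega, by omega⟩)))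
  · by_contra hlt
    rcases sb.2.2 with h | h
    · omega
    · exact sb'.1 (L - rb η) (Finset.mem_Icc.mpr ⟨by omega, by omega⟩) (hsub h)

open Classical in
/-- **Traces are monotone**: for `ω ⊆ ω'` the red traces grow and the blue traces shrink (any gate). [folklore] -/
theorem hubB_trace_mono (ℓ : ℕ → ℕ) (hℓ : ∀ t, 1 ≤ ℓ t)
    (θ : ℕ → Finset (ℕ × ℕ) → Finset ℕ) (hθ : ∀ t ω k, k ∈ θ t ω ↔ (t, k) ∈ ω)
    (D : ℕ → Finset ℕ → Finset ℕ) (hD : ∀ t η, D t η = (Icc 1 (ℓ t - 1)).filter (fun k => ¬ (k ∈ η ↔ k + 1 ∈ η)))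
    (ri ra rj rb : ℕ → Finset ℕ → ℕ)
    (hri : ∀ t η, ri t η = if 1 ∈ η then (if h : (D t η).Nonempty then (D t η).min' h else ℓ t) else 0)
    (hra : ∀ t η, ra t η = if 1 ∈ η then 0 else (if h : (D t η).Nonempty then (D t η).min' h else ℓ t))
    (hrj : ∀ t η, rj t η = if ℓ t ∈ η then (if h : (D t η).Nonempty then ℓ t - (D t η).max' h else ℓ t) else 0)
    (hrb : ∀ t η, rb t η = if ℓ t ∈ η then 0 else (if h : (D t η).Nonempty then ℓ t - (D t η).max' h else ℓ t))
    (TX TY : Bool → ℕ → Finset (ℕ × ℕ) → Finset (ℕ × ℕ))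
    (hTX : ∀ g n ω, TX g n ω = (range n).biUnion (fun t => (Icc 0 (ri t (θ t ω)) ∪
      (if (g = true ∨ ∃ s, s < n ∧ ri s (θ s ω) = ℓ s) then Icc (ℓ t - rj t (θ t ω)) (ℓ t) else ∅)).image (Prod.mk t)))
    (hTY : ∀ g n ω, TY g n ω = (range n).biUnion (fun t => (Icc 0 (ra t (θ t ω)) ∪
      (if (g = true ∨ ∃ s, s < n ∧ ra s (θ s ω) = ℓ s) then Icc (ℓ t - rb t (θ t ω)) (ℓ t) else ∅)).image (Prod.mk t)))
    (g : Bool) (n : ℕ) (ω ω' : Finset (ℕ × ℕ)) (hsub : ω ⊆ ω') :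
    TX g n ω ⊆ TX g n ω' ∧ TY g n ω' ⊆ TY g n ω := by
  have hm : ∀ t, ri t (θ t ω) ≤ ri t (θ t ω') ∧ ra t (θ t ω') ≤ ra t (θ t ω) ∧ rj t (θ t ω) ≤ rj t (θ t ω') ∧
      rb t (θ t ω') ≤ rb t (θ t ω) := fun t =>
    hubB_runs_mono (ℓ t) (hℓ t) (D t) (hD t) (ri t) (ra t) (rj t) (rb t) (hri t) (hra t) (hrj t) (hrb t) _ _
      (hubB_theta_mono θ hθ ω ω' hsub t)
  have hle : ∀ t η, ri t η ≤ ℓ t ∧ ra t η ≤ ℓ t := fun t η =>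
    let h4 := hubB_runs_le (ℓ t) (D t) (hD t) (ri t) (ra t) (rj t) (rb t) (hri t) (hra t) (hrj t) (hrb t) η
    ⟨h4.1, h4.2.1⟩
  constructor
  · intro p hp
    rw [hubB_mem_trace ℓ θ ri rj TX hTX] at hp ⊢
    refine ⟨hp.1, ?_⟩
    rcases hp.2 with h | ⟨hc, h2, h3⟩
    · exact Or.inl (le_trans h (hm p.1).1)
    · right
      refine ⟨?_, le_trans (Nat.sub_le_sub_left (hm p.1).2.2.1 _) h2, h3⟩
      rcases hc with hc | ⟨s, hs, hfs⟩
      · exact Or.inl hc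
      · exact Or.inr ⟨s, hs, le_antisymm (hle s _).1 (by rw [← hfs]; exact (hm s).1)⟩
  · intro p hp
    rw [hubB_mem_trace ℓ θ ra rb TY hTY] at hp ⊢
    refine ⟨hp.1, ?_⟩
    rcases hp.2 with h | ⟨hc, h2, h3⟩
    · exact Or.inl (le_trans h (hm p.1).2.1)
    · right
      refine ⟨?_, le_trans (Nat.sub_le_sub_left (hm p.1).2.2.2 _) h2, h3⟩
      rcases hc with hc | ⟨s, hs, hfs⟩
      · exact Or.inl hc
      · exact Or.inr ⟨s, hs, le_antisymm (hle s _).2 (by rw [← hfs]; exact (hm s).2.1)⟩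

end Coefficientwise

end Summit.CriticalPhenomena.PercolationContinuityZ3.Theorems
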